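import Summits.CriticalPhenomena.CardyFormulaZ2.Theses.CardyRotToConf

/-!
# Birth skeleton of the crux `CardyRotToConfDiscretisationsExist` (stmt-CriticalPhenomena-8600, route `CardyRotToConf`)

The crux (rank 9; the route's non-vacuity guard for X, R3, R4 — `closes` takes it as its last
hypothesis): every Dobrushin domain `(D; a, b)` admits a family `E : ℝ → DiscreteDobrushin` of
square-lattice Dobrushin data with `IsDiscretisation D E` — exact domain `(E δ).Ω = D.carrier` and mesh
`(E δ).δ = δ` at EVERY real `δ`, the two (free) arcs of the data converging to `(ab) = D.arc 0` and
`(ba) = D.arc 1` in Hausdorff extended distance as `δ → 0⁺`, the midpoints of the discrete `A`–`B` edges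
converging to `{a, b}`, and `IsZdAdmissible` (no tie on `zdBoundary`, exactly two `A`–`B` edges, each a side
of exactly one inner face) for all small `δ > 0`.

Line `birth` separates the two things such a family asserts:

* `stub_admissibleDataAtTolerance` — THE GEOMETRIC HEART (finite lattice topology of `Ω ∩ δℤ²` near a
  Jordan curve with two marked prime ends): for every tolerance `η > 0` and all small meshes `δ` there are
  admissible Dobrushin data on `(D.carrier, δ)` whose arcs are `η`-close to `(ab)`, `(ba)` and whose
  discrete marked points are `η`-close to `{a, b}`.  No convergence, no family: one mesh at a time.
* `stub_diagonalTolerance` — THE ANALYTIC STEP (diagonal selection along `δ → 0⁺`, for an ARBITRARY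
  predicate `Q δ η`): if every tolerance `η > 0` is eventually-in-`δ` achievable then some tolerance
  function `ε δ → 0⁺` is eventually achieved (`Q δ (ε δ)` with `0 < ε δ`).  The infimum trick.
* `CardyRotToConfDiscretisationsExist_of` (proved here, no `sorry` outside the two stubs, which it uses
  BY NAME) — the packaging: choose the `ε δ`-good data where they exist and the arc-less canonical data
  `⟨D.carrier, δ, ∅, ∅⟩` elsewhere (so `Ω_eq`, `δ_eq` hold at every real `δ`), and squeeze the three
  Hausdorff distances between `0` and `ENNReal.ofReal (ε δ) → 0`.  Its type is literally the route decl.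

Provable now (for the idle prover; sizes S–M):
`stub_admissibleDataAtTolerance` follows in a dozen lines from the LANDED tree theorem
`Summit.CriticalPhenomena.CardyFormulaZ2.Cruxes.LagHandOff.HittingTournament.stub_discretisable :
∀ D, ∃ E, ZdDiscretisationFamily D E` (Theorems/CardySelfRefinementLagHandOffDiscretisable.lean: take
`E δ` itself; the three `Tendsto … (𝓝 0)` fields give `≤ ENNReal.ofReal η` eventually since
`0 < ENNReal.ofReal η`, and `eventually_isZdAdmissible`, `Ω_eq`, `δ_eq` give the rest), or directly from
`DiscretisationFamilyExists.eventually_labelling` + the marker construction of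
`CrosscutDictionary.exists_markers_of_labelling`; `stub_diagonalTolerance` is the infimum trick spelled
out for a specific predicate inside that same file (the `obtain ⟨ε, hε, hgood⟩` block, ≈ 30 lines).
The crux itself is also two lines from `stub_discretisable` and
`Literature.Probability.LatticeModels.ZdDiscretisationFamily.toIsDiscretisation` (route header, r7).

Disproof used: none on file for this crux (`ledger crux ls stmt-CriticalPhenomena-8600`: no workfiles at
registration time); the negatives index of CriticalPhenomena has no statement about discretisation
families.  Non-vacuity caveat honoured: the stubs never use the canonical distance-comparison data of a
lattice-resonant domain (which tie: `not_isZdAdmissible_dobrushinData_unitDisc`) — the arcs are free.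
-/

namespace Summit.CriticalPhenomena.CardyFormulaZ2.Cruxes.CardyRotToConfDiscretisationsExist.Birth

open Filter Topology
open Literature.Probability.LatticeModels Literature.Probability.RandomPlanarGeometry

/-- **STUB (geometric heart) — admissible Dobrushin data at every tolerance, for all small meshes.**
For every Dobrushin domain `(D; a, b)` and every `η > 0`, eventually as `δ → 0⁺` there are Dobrushin data
`E = ⟨D.carrier, δ, arcA, arcB⟩` which are `IsZdAdmissible` (bounded, `δ > 0`, disjoint nonempty discrete
arcs covering `zdBoundary`, exactly two `A`–`B` edges each bordering exactly one inner face) with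
`d_H(arcA, (ab)) ≤ η`, `d_H(arcB, (ba)) ≤ η` and the midpoints of the `A`–`B` edges within `η` of `{a, b}`
(Hausdorff extended distances).  Why plausibly true: the outer boundary circuit of the bulk component of
`Ω ∩ δℤ²` passes within `O(δ)`-to-`o(1)` of `a` and of `b` (Carathéodory: prime ends are accessible), cut it
there into two sides and take free arcs shadowing the sides off the tie locus; in tree this is
`DiscretisationFamilyExists.eventually_labelling` + `CrosscutDictionary.exists_markers_of_labelling`, and
the whole statement follows from `HittingTournament.stub_discretisable`.  Why it might fail: only as
mis-typing — e.g. if `IsZdAdmissible.zdABEdges_inner` could not be met near a marked point where `∂D`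
oscillates (it can: the labelling theorem is proved).  Size: M (S given the tree).  Leans on:
`DiscreteDobrushin.IsZdAdmissible`, `DiscreteDobrushin.zdABEdges`, `medialPoint`, `MarkedDomain.arc/pt`. -/
theorem stub_admissibleDataAtTolerance :
    ∀ (D : Literature.Probability.RandomPlanarGeometry.DobrushinDomain) (η : ℝ), 0 < η → ∀ᶠ δ in nhdsWithin (0 : ℝ) (Set.Ioi 0), ∃ E : Literature.Probability.LatticeModels.DiscreteDobrushin, E.Ω = D.carrier ∧ E.δ = δ ∧ E.IsZdAdmissible ∧ Metric.hausdorffEDist E.arcA (D.arc 0) ≤ ENNReal.ofReal η ∧ Metric.hausdorffEDist E.arcB (D.arc 1) ≤ ENNReal.ofReal η ∧ Metric.hausdorffEDist (Literature.Probability.LatticeModels.medialPoint δ '' E.zdABEdges) {D.pt 0, D.pt 1} ≤ ENNReal.ofReal η := by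
  sorry

/-- **STUB (analytic step) — diagonal selection of a vanishing tolerance.**  For an arbitrary predicate
`Q δ η` on (mesh, tolerance): if every `η > 0` holds eventually as `δ → 0⁺`, then there is a tolerance
FUNCTION `ε` with `ε δ → 0` as `δ → 0⁺` and, eventually, `0 < ε δ ∧ Q δ (ε δ)`.  Why true: the infimum
trick — at each small `δ` the set `G δ = {η > 0 | Q δ η}` is nonempty (it contains `1` eventually) and
bounded below; choose `ε δ ∈ G δ` with `ε δ < inf (G δ) + δ`; for `e > 0`, eventually `e/2 ∈ G δ` and
`δ < e/2`, so `0 < ε δ < e`.  No monotonicity of `Q` in `η` is needed.  Why it might fail: it does not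
(choice + conditionally complete order on `ℝ`); it is a stub because it is a separate, reusable lemma the
packaging consumes, ≈ 30 lines (model: the `obtain ⟨ε, hε, hgood⟩` block of
Theorems/CardySelfRefinementLagHandOffDiscretisable.lean).  Size: S.  Leans on: `exists_lt_of_csInf_lt`,
`csInf_le`, `Metric.tendsto_nhds`, `self_mem_nhdsWithin`, `Ioo_mem_nhdsGT`. -/
theorem stub_diagonalTolerance :
    ∀ Q : ℝ → ℝ → Prop, (∀ η : ℝ, 0 < η → ∀ᶠ δ in nhdsWithin (0 : ℝ) (Set.Ioi 0), Q δ η) → ∃ ε : ℝ → ℝ, Filter.Tendsto ε (nhdsWithin (0 : ℝ) (Set.Ioi 0)) (nhds 0) ∧ ∀ᶠ δ in nhdsWithin (0 : ℝ) (Set.Ioi 0), 0 < ε δ ∧ Q δ (ε δ) := by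
  sorry

/-- **Packaging (proved).** A family `E : ℝ → DiscreteDobrushin` with exact domain and mesh at every
real `δ`, which eventually (as `δ → 0⁺`) is admissible with both arcs and the discrete marked points within
`ENNReal.ofReal (ε δ)` of `(ab)`, `(ba)`, `{a, b}` for some real tolerance function `ε δ → 0`, is an
`IsDiscretisation` family: the three Hausdorff extended distances are squeezed between `0` and
`ENNReal.ofReal (ε δ) → 0`. [folklore] -/
theorem isDiscretisation_of_selection (D : DobrushinDomain) (ε : ℝ → ℝ) (E : ℝ → DiscreteDobrushin)
    (hε : Tendsto ε (𝓝[>] 0) (𝓝 0)) (hΩ : ∀ δ, (E δ).Ω = D.carrier) (hδ : ∀ δ, (E δ).δ = δ)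
    (hev : ∀ᶠ δ in 𝓝[>] (0 : ℝ), (E δ).IsZdAdmissible ∧
      Metric.hausdorffEDist (E δ).arcA (D.arc 0) ≤ ENNReal.ofReal (ε δ) ∧
      Metric.hausdorffEDist (E δ).arcB (D.arc 1) ≤ ENNReal.ofReal (ε δ) ∧
      Metric.hausdorffEDist (medialPoint δ '' (E δ).zdABEdges) {D.pt 0, D.pt 1} ≤
        ENNReal.ofReal (ε δ)) :
    IsDiscretisation D E := by
  have h0 : Tendsto (fun δ : ℝ => ENNReal.ofReal (ε δ)) (𝓝[>] 0) (𝓝 0) := by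
    rw [← ENNReal.ofReal_zero]
    exact ENNReal.tendsto_ofReal hε
  have squeeze : ∀ u : ℝ → ENNReal, (∀ᶠ δ in 𝓝[>] (0 : ℝ), u δ ≤ ENNReal.ofReal (ε δ)) →
      Tendsto u (𝓝[>] 0) (𝓝 0) := fun u hu =>
    tendsto_of_tendsto_of_tendsto_of_le_of_le' tendsto_const_nhds h0
      (Eventually.of_forall fun δ => zero_le) hu
  exact ⟨hΩ, hδ,
    squeeze (fun δ => Metric.hausdorffEDist (E δ).arcA (D.arc 0)) (hev.mono fun δ h => h.2.1),
    squeeze (fun δ => Metric.hausdorffEDist (E δ).arcB (D.arc 1)) (hev.mono fun δ h => h.2.2.1),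
    squeeze (fun δ => Metric.hausdorffEDist (medialPoint δ '' (E δ).zdABEdges) {D.pt 0, D.pt 1})
      (hev.mono fun δ h => h.2.2.2),
    hev.mono fun δ h => h.1⟩

/-- **The line closes the crux** (the skeleton's concluding theorem; its only unproved dependencies are
the two declared stubs, used BY NAME): `CardyRotToConf.CardyRotToConfDiscretisationsExist`.  Diagonalise
the tolerance-wise data of `stub_admissibleDataAtTolerance` with `stub_diagonalTolerance`; select the
`ε δ`-good data where they exist and `⟨D.carrier, δ, ∅, ∅⟩` elsewhere (exact domain and mesh at every real
`δ`); conclude with the packaging `isDiscretisation_of_selection`.  (With the two stub names replaced by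
hypotheses of the same types this proof term is closed: axioms `propext`, `Classical.choice`,
`Quot.sound` — certificate `bc/CardyRotToConfDiscretisationsExist_of_hypotheses.lean` of the registering
planner, 2026-08-17.) -/
theorem CardyRotToConfDiscretisationsExist_of :
    Summit.CriticalPhenomena.CardyFormulaZ2.Theses.CardyRotToConf.CardyRotToConfDiscretisationsExist := by
  intro D
  classical
  -- (1) tolerance-wise admissible data (stub), diagonalised along `δ → 0⁺` (stub)
  obtain ⟨ε, hε, hgood⟩ := stub_diagonalTolerance
    (fun δ η => ∃ E : DiscreteDobrushin, E.Ω = D.carrier ∧ E.δ = δ ∧ E.IsZdAdmissible ∧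
      Metric.hausdorffEDist E.arcA (D.arc 0) ≤ ENNReal.ofReal η ∧
      Metric.hausdorffEDist E.arcB (D.arc 1) ≤ ENNReal.ofReal η ∧
      Metric.hausdorffEDist (medialPoint δ '' E.zdABEdges) {D.pt 0, D.pt 1} ≤ ENNReal.ofReal η)
    (stub_admissibleDataAtTolerance D)
  -- (2) selection at every real mesh: a witness where one exists, `⟨D.carrier, δ, ∅, ∅⟩` elsewhere
  have hsel : ∀ C : ℝ → DiscreteDobrushin → Prop, (∀ δ E', C δ E' → E'.Ω = D.carrier ∧ E'.δ = δ) →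
      ∃ E : ℝ → DiscreteDobrushin, (∀ δ, (E δ).Ω = D.carrier) ∧ (∀ δ, (E δ).δ = δ) ∧
        ∀ δ, (∃ E', C δ E') → C δ (E δ) := by
    intro C hC
    have key : ∀ δ : ℝ, ∃ E : DiscreteDobrushin, E.Ω = D.carrier ∧ E.δ = δ ∧ ((∃ E', C δ E') → C δ E) := by
      intro δ
      by_cases h : ∃ E', C δ E'
      · obtain ⟨E', hE'⟩ := h
        exact ⟨E', (hC δ E' hE').1, (hC δ E' hE').2, fun _ => hE'⟩
      · exact ⟨⟨D.carrier, δ, ∅, ∅⟩, rfl, rfl, fun h' => (h h').elim⟩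
    choose E hΩ hδ hE using key
    exact ⟨E, hΩ, hδ, hE⟩
  obtain ⟨E, hΩ, hδ, hE⟩ := hsel
    (fun δ E' => E'.Ω = D.carrier ∧ E'.δ = δ ∧ E'.IsZdAdmissible ∧
      Metric.hausdorffEDist E'.arcA (D.arc 0) ≤ ENNReal.ofReal (ε δ) ∧
      Metric.hausdorffEDist E'.arcB (D.arc 1) ≤ ENNReal.ofReal (ε δ) ∧
      Metric.hausdorffEDist (medialPoint δ '' E'.zdABEdges) {D.pt 0, D.pt 1} ≤ ENNReal.ofReal (ε δ))
    (fun δ E' h => ⟨h.1, h.2.1⟩)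
  -- (3) packaging
  exact ⟨E, isDiscretisation_of_selection D ε E hε hΩ hδ (hgood.mono fun δ h => (hE δ h.2).2.2)⟩

end Summit.CriticalPhenomena.CardyFormulaZ2.Cruxes.CardyRotToConfDiscretisationsExist.Birth
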